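import Literature.NumberTheory.LFunctions.Zhang2022.Section12Top1522Glue
import Literature.NumberTheory.LFunctions.Zhang2022.Section12TopRangeA15

/-!
# Zhang (2022) §12 p. 73: the RT-02 node `Top1522Ex` and the leaf (12.16) `Eq1216` HOLD — unconditional closers

Topic `Literature/NumberTheory/LFunctions/Zhang2022` (Landau–Siegel audit tree; verdict-neutral).
Y. Zhang, *Discrete mean estimates and the Landau–Siegel zero*, arXiv:2211.02515v1 (2022)
[Zhang2022LandauSiegel]. **Status of the source: an unrefereed manuscript under adjudication**; everything in this
file is PROVED (theorems only; no new definitions, no new facts); nothing here is a claim about Theorems 1–2 of the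
source or about Landau–Siegel zeros.

The node of record `Typed.Sec12C.Top1522Ex c′` (ruling R-18: the top range `P″₁ < dr < P₂` of `S_j(𝐚₁₅,𝐚₂₂)`, §12.u049
p. 73 tex L3694–L3702, with Zhang's own exact weight `𝓦*_j` of the proof of Lemma 12.1) is assembled from three
tree theorems:

1. the EVAL half as an edge from the relative Lemma 8.4 (zl-w12-p9, `Section12TopRangeA15`):
   `sjOn_top_a15_sum_of_rel : Lemma84Rel c′ → (S_j|_{P″₁<dr<P₂} = X₆ + X₇ + o(α))`, with the `n`-windows
   `P″₁ < n < P₃` and `P″₁ < n < P₂` the re-indexing `n = dr` actually produces;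
2. the RANGE BRIDGE proved here (`sumEx_sub_windows`): the typed first line `main12u049sumEx` uses the PRINTED windows
   `P^{0.496} < n < P^{0.498}`, `P^{0.496} < n < P^{0.5}` (`winSum`); the difference consists of the boundary windows
   `(P^{0.496}, P″₁]` (log-length `log(Dt₀) ≤ 520𝓛`) and `[P₂, P^{0.5})` (log-length `10 log T = 10𝓛^{1.1}`), whose
   weights sum to `≤ e^{256}(3 + 520𝓛)` resp. `≤ e^{256}(3 + 10𝓛^{1.1})` (`Ranges1422.sum_weights_le`) against the
   bounded profile (`topG1522_bounds`: `≤ 146(1+7π)`) and the prefactors `‖L′²ι/(0.504θlog²P)‖ ≤ 150e⁹𝓛⁴/𝓛¹⁸` — total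
   `≪ 𝓛^{6}/𝓛^{18} ≤ εα`;
3. the INT half `main12u049sumEx_sub_intEx` (zl-w12-p7, `Section12Top1522Int`) through the glue `top1522Ex_of_eval`;

and the relative Lemma 8.4 is a THEOREM (`lemma84Rel_of_lemma83Rel ∘ Lemma83.lemma83Rel_of_parts` at the App. A theorems
`stepA_u007_analytic_holds`, `stepA_u007_read_holds`, as in `Section12Low1522Leaves`). Hence

* **`top1522Ex_holds : ∀ c′, Typed.Sec12C.Top1522Ex c′`** — the v20+ binder `hTop1522`/`hTop22Ex` is a theorem;
* **`eq1216_holds : ∀ c′, Typed.Sec12C.Eq1216 c′`** — the v19 leaf `h1216` ((12.16) AS PRINTED) is a theorem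
  (`Sec12D.eq1216_of_top1522Ex`, p476025).

## References

* Y. Zhang, arXiv:2211.02515v1 (2022), §12 p. 73 (u049, (12.16)); §8 (8.10) p. 47; §2 (2.21). [cite: Zhang2022LandauSiegel, §12 (12.16) p.73]
-/

noncomputable section

open Complex Real ComplexConjugate
open Literature.NumberTheory.LFunctions.Zhang2022
open Literature.NumberTheory.LFunctions.Zhang2022.Skeleton
open Literature.NumberTheory.LFunctions.Zhang2022.Typed.Sec10C (forAllLarge_five_c one_le_bigP norm_iota34_le)
open Literature.NumberTheory.LFunctions.Zhang2022.Typed.Sec10C.Ranges1422 (sum_weights_le range_facts bigT_pos)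

namespace Literature.NumberTheory.LFunctions.Zhang2022.Typed.Sec12C

section Bridge

variable (c' : ℝ) {D : ℕ} (χ : DirichletCharacter ℂ D)

/-- **Pointwise size of one window summand of u049**: for `1 ≤ n ≤ P` (and `1 ≤ Q ≤ P`, large `D`),
`‖|χ(n)|λ₀ⱼ(n)φ(n)⁻¹·𝓖_{jμ}(Q/n)𝓦*ˣ_j(n)‖ ≤ 146(1+7π)·‖|χ(n)|λ₀ⱼ(n)/n‖(n/φ(n))³` (`φ(n) ≤ n`, `topG1522_bounds`).
[cite: Zhang2022LandauSiegel, §12 (12.16) p.73] -/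
theorem norm_window_summand_le (j μ : ℕ) (hℓ3 : 3 ≤ ell D) (hc5 : 5 * |c'| * alpha D * ell D ≤ 1)
    {Q : ℝ} (hQ1 : 1 ≤ Q) (hQP : Q ≤ bigP D) {n : ℕ} (hn1 : 1 ≤ n) (hnP : (n : ℝ) ≤ bigP D) :
    ‖(‖χ (n : ZMod D)‖ : ℂ) * lamZero c' D j n / (Nat.totient n : ℂ) *
        (frakgW c' D j μ (Q / n) * frakwStarEx c' D j n)‖ ≤
      146 * (1 * (1 + 7 * π)) *
        (‖(‖χ (n : ZMod D)‖ : ℂ) * lamZero c' D j n / (n : ℂ)‖ * ((n : ℝ) / Nat.totient n) ^ 3) := by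
  have hℓ1' : 1 ≤ Real.log D := by rw [← ell]; linarith
  have hα : 0 < alpha D := Sec12D.alpha_pos_of_log hℓ1'
  have hP1pp1 := one_le_P1pp (D := D) hℓ3
  have hP1ppP := P1pp_le_bigP (D := D) hℓ3
  have hn1' : (1 : ℝ) ≤ n := by exact_mod_cast hn1
  have hn0 : (0 : ℝ) < n := by linarith
  have hφ0 : (0 : ℝ) < Nat.totient n := by exact_mod_cast Nat.totient_pos.mpr (by omega)
  have hφn : (Nat.totient n : ℝ) ≤ n := by exact_mod_cast Nat.totient_le n
  -- the profile bound at `t = n`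
  obtain ⟨-, hG, -⟩ := topG1522_bounds c' j μ hα (by linarith) hc5 hQ1 hQP hP1pp1 hP1ppP hn1' hnP
  rw [← frakwStarEx_eq_exp c' (by linarith) j hn0] at hG
  -- norms of the arithmetic weights
  have e1 : ‖(‖χ (n : ZMod D)‖ : ℂ) * lamZero c' D j n / (Nat.totient n : ℂ) *
        (frakgW c' D j μ (Q / n) * frakwStarEx c' D j n)‖ =
      ‖χ (n : ZMod D)‖ * ‖lamZero c' D j n‖ / Nat.totient n *
        ‖frakgW c' D j μ (Q / n) * frakwStarEx c' D j n‖ := by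
    rw [norm_mul, norm_div, norm_mul, Complex.norm_real, Real.norm_of_nonneg (norm_nonneg _),
      Complex.norm_natCast]
  have e2 : ‖(‖χ (n : ZMod D)‖ : ℂ) * lamZero c' D j n / (n : ℂ)‖ * ((n : ℝ) / Nat.totient n) ^ 3 =
      ‖χ (n : ZMod D)‖ * ‖lamZero c' D j n‖ / Nat.totient n * ((n : ℝ) / Nat.totient n) ^ 2 := by
    rw [norm_div, norm_mul, Complex.norm_real, Real.norm_of_nonneg (norm_nonneg _), Complex.norm_natCast]
    field_simp
  rw [e1, e2]
  have hw0 : 0 ≤ ‖χ (n : ZMod D)‖ * ‖lamZero c' D j n‖ / Nat.totient n := by positivity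
  have hr : 1 ≤ ((n : ℝ) / Nat.totient n) ^ 2 := by
    have : 1 ≤ (n : ℝ) / Nat.totient n := by rw [le_div_iff₀ hφ0]; linarith
    nlinarith
  calc ‖χ (n : ZMod D)‖ * ‖lamZero c' D j n‖ / Nat.totient n * ‖frakgW c' D j μ (Q / n) * frakwStarEx c' D j n‖
      ≤ ‖χ (n : ZMod D)‖ * ‖lamZero c' D j n‖ / Nat.totient n * (146 * (1 * (1 + 7 * π))) :=
        mul_le_mul_of_nonneg_left hG hw0
    _ ≤ ‖χ (n : ZMod D)‖ * ‖lamZero c' D j n‖ / Nat.totient n * (146 * (1 * (1 + 7 * π))) *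
          ((n : ℝ) / Nat.totient n) ^ 2 := le_mul_of_one_le_right (by positivity) hr
    _ = 146 * (1 * (1 + 7 * π)) *
          (‖χ (n : ZMod D)‖ * ‖lamZero c' D j n‖ / Nat.totient n * ((n : ℝ) / Nat.totient n) ^ 2) := by ring

/-- **A boundary window contributes little**: if every `n ∈ S` lies in `[u, v] ⊆ [1, P]` with `2 ≤ u ≤ v` (and
`1 ≤ Q ≤ P`), then `‖Σ_{n∈S}|χ(n)|λ₀ⱼ(n)φ(n)⁻¹𝓖_{jμ}(Q/n)𝓦*ˣ_j(n)‖ ≤ 146(1+7π)e^{256}(3 + log v − log u)`.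
[cite: Zhang2022LandauSiegel, §12 (12.16) p.73] -/
theorem norm_boundary_window_le (j μ : ℕ) (hℓ3 : 3 ≤ ell D) (hc5 : 5 * |c'| * alpha D * ell D ≤ 1)
    {Q : ℝ} (hQ1 : 1 ≤ Q) (hQP : Q ≤ bigP D) {S : Finset ℕ} {u v : ℝ} (hu : 2 ≤ u) (huv : u ≤ v)
    (hvP : v ≤ bigP D) (hS : ∀ n ∈ S, u ≤ (n : ℝ) ∧ (n : ℝ) ≤ v) :
    ‖∑ n ∈ S, (‖χ (n : ZMod D)‖ : ℂ) * lamZero c' D j n / (Nat.totient n : ℂ) *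
        (frakgW c' D j μ (Q / n) * frakwStarEx c' D j n)‖ ≤
      146 * (1 * (1 + 7 * π)) * (Real.exp 256 * (3 + Real.log v - Real.log u)) := by
  have hW := sum_weights_le c' χ j hu huv hS
  calc ‖∑ n ∈ S, (‖χ (n : ZMod D)‖ : ℂ) * lamZero c' D j n / (Nat.totient n : ℂ) *
          (frakgW c' D j μ (Q / n) * frakwStarEx c' D j n)‖
      ≤ ∑ n ∈ S, ‖(‖χ (n : ZMod D)‖ : ℂ) * lamZero c' D j n / (Nat.totient n : ℂ) *
          (frakgW c' D j μ (Q / n) * frakwStarEx c' D j n)‖ := norm_sum_le _ _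
    _ ≤ ∑ n ∈ S, 146 * (1 * (1 + 7 * π)) *
          (‖(‖χ (n : ZMod D)‖ : ℂ) * lamZero c' D j n / (n : ℂ)‖ * ((n : ℝ) / Nat.totient n) ^ 3) := by
        refine Finset.sum_le_sum fun n hn => ?_
        obtain ⟨h1, h2⟩ := hS n hn
        have hn1 : 1 ≤ n := by exact_mod_cast (show (1 : ℝ) ≤ n by linarith)
        exact norm_window_summand_le c' χ j μ hℓ3 hc5 hQ1 hQP hn1 (by linarith)
    _ = 146 * (1 * (1 + 7 * π)) *
          ∑ n ∈ S, ‖(‖χ (n : ZMod D)‖ : ℂ) * lamZero c' D j n / (n : ℂ)‖ * ((n : ℝ) / Nat.totient n) ^ 3 := by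
        rw [Finset.mul_sum]
    _ ≤ 146 * (1 * (1 + 7 * π)) * (Real.exp 256 * (3 + Real.log v - Real.log u)) :=
        mul_le_mul_of_nonneg_left hW (by positivity)

/-- Logarithmic lengths of the two boundary windows: `log P″₁ − log P^{0.496} = 𝓛 + 519 log 𝓛 ≤ 520𝓛` and
`log P^{0.5} − log P₂ = 10·𝓛^{1.1} ≤ 10𝓛²` (`𝓛 ≥ 3`). [cite: Zhang2022LandauSiegel, §2 (2.21), §12 p.67] -/
theorem boundary_log_lengths (hℓ3 : 3 ≤ ell D) :
    Real.log (P1pp D) - Real.log (bigP D ^ (0.496 : ℝ)) ≤ 520 * ell D ∧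
      Real.log (bigP D ^ (0.5 : ℝ)) - Real.log (Skeleton.P2 D) ≤ 10 * ell D ^ 2 := by
  have hℓ1 : 1 ≤ ell D := by linarith
  have hℓ0 : 0 < ell D := by linarith
  have hℓ1' : 1 ≤ Real.log D := by rw [← ell]; exact hℓ1
  have hP0 := bigP_pos D
  have hP1pp0 : 0 < P1pp D := Sec12D.P1pp_pos hℓ1'
  constructor
  · have h := Sec12D.log_rpow_div_P1pp (D := D) hℓ1' 0.496
    rw [Real.log_div (Real.rpow_pos_of_pos hP0 _).ne' hP1pp0.ne'] at h
    have hlog : Real.log (ell D) ≤ ell D := (Real.log_le_sub_one_of_pos hℓ0).trans (by linarith)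
    have : Real.log (P1pp D) - Real.log (bigP D ^ (0.496 : ℝ)) = ell D + 519 * Real.log (ell D) := by
      linarith
    rw [this]; nlinarith
  · have hT := bigT_pos D
    rw [Skeleton.P2, Real.log_div (Real.rpow_pos_of_pos hP0 _).ne' (pow_pos hT 10).ne', Real.log_pow,
      Skeleton.log_bigT]
    have h11 : ell D ^ (1.1 : ℝ) ≤ ell D ^ (2 : ℝ) := Real.rpow_le_rpow_of_exponent_le hℓ1 (by norm_num)
    rw [Real.rpow_two] at h11
    push_cast
    nlinarith

omit χ in
/-- Arithmetic of the final `o(α)` bound of the bridge. [folklore] -/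
private theorem arith_bridge {ℓ ε A W nK6 nK7 b6 b7 : ℝ} (hℓ : 1 ≤ ℓ) (hε : 0 < ε) (hA : 0 ≤ A) (hW : 0 ≤ W)
    (hK6 : nK6 ≤ A * ℓ ^ 4 / ℓ ^ 18) (hK7 : nK7 ≤ A * ℓ ^ 4 / ℓ ^ 18)
    (hb6 : b6 ≤ W * (523 * ℓ ^ 2)) (hb7 : b7 ≤ W * (1059 * ℓ ^ 2)) (hb60 : 0 ≤ b6) (hb70 : 0 ≤ b7)
    (hbig : A * W * 1582 / (ε * π) + 1 ≤ ℓ) :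
    nK6 * b6 + nK7 * b7 ≤ ε * (π / ℓ ^ 9) := by
  have hℓ0 : 0 < ℓ := by linarith
  have h1 : nK6 * b6 + nK7 * b7 ≤ A * ℓ ^ 4 / ℓ ^ 18 * (W * (1582 * ℓ ^ 2)) := by
    have e : A * ℓ ^ 4 / ℓ ^ 18 * (W * (1582 * ℓ ^ 2)) =
        A * ℓ ^ 4 / ℓ ^ 18 * (W * (523 * ℓ ^ 2)) + A * ℓ ^ 4 / ℓ ^ 18 * (W * (1059 * ℓ ^ 2)) := by ring
    rw [e]
    exact add_le_add (mul_le_mul hK6 hb6 hb60 (by positivity)) (mul_le_mul hK7 hb7 hb70 (by positivity))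
  have h2 : A * ℓ ^ 4 / ℓ ^ 18 * (W * (1582 * ℓ ^ 2)) = (A * W * 1582) / ℓ ^ 3 / ℓ ^ 9 := by
    field_simp
  have hεπ : 0 < ε * π := by positivity
  have h3 : A * W * 1582 ≤ ε * π * ℓ ^ 3 := by
    have h4 : A * W * 1582 / (ε * π) ≤ ℓ := by linarith
    rw [div_le_iff₀ hεπ] at h4
    have h5 : ℓ ≤ ℓ ^ 3 := by nlinarith
    have : 0 ≤ A * W * 1582 := by positivity
    nlinarith
  rw [h2] at h1
  refine h1.trans ?_
  rw [div_div, div_le_iff₀ (by positivity)]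
  calc A * W * 1582 ≤ ε * π * ℓ ^ 3 := h3
    _ = ε * (π / ℓ ^ 9) * (ℓ ^ 3 * ℓ ^ 9) := by field_simp

/-- **Boundary window `μ = 6`**: the printed window sum `Σ_{P^{0.496}<n<P^{0.498}}` minus zl-w12-p9's
`Σ_{P″₁<n<P₃, n<⌈PT⁻²⌉}` is the sum over `(P^{0.496}, P″₁]`, of norm `≤ 146(1+7π)e^{256}·523𝓛²`.
[cite: Zhang2022LandauSiegel, §12 (12.16) p.73] -/
theorem window6_bridge (j : ℕ) (hℓ4 : 4 ≤ ell D) (hc5 : 5 * |c'| * alpha D * ell D ≤ 1) :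
    ‖winSum c' χ j (bigP D ^ (0.496 : ℝ)) (bigP D ^ (0.498 : ℝ))
          (fun n => frakgW c' D j 6 (bigP D ^ (0.498 : ℝ) / n) * frakwStarEx c' D j n) -
        ∑ n ∈ (Finset.Ico 1 (Nsupp D)).filter (fun n : ℕ => P1pp D < n ∧ (n : ℝ) < Skeleton.P3 D),
          (‖χ (n : ZMod D)‖ : ℂ) * lamZero c' D j n / (Nat.totient n : ℂ) *
            (frakgW c' D j 6 (bigP D ^ (0.498 : ℝ) / n) * frakwStarEx c' D j n)‖ ≤
      146 * (1 * (1 + 7 * π)) * Real.exp 256 * (523 * ell D ^ 2) := by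
  have hℓ3 : 3 ≤ ell D := by linarith
  have hℓ1 : 1 ≤ ell D := by linarith
  have hP1 : 1 ≤ bigP D := one_le_bigP D
  obtain ⟨h2, -, h80, h04, -, h5P, hN⟩ := range_facts (D := D) hℓ3
  obtain ⟨h496, -, -, hP3def, -⟩ := TopRangeA15.window_facts (D := D) hℓ3
  have hP1ppP := P1pp_le_bigP (D := D) hℓ3
  have hQ6 : 1 ≤ bigP D ^ (0.498 : ℝ) := Real.one_le_rpow hP1 (by norm_num)
  have hQ6P : bigP D ^ (0.498 : ℝ) ≤ bigP D := h80.trans h5P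
  obtain ⟨hlen6, -⟩ := boundary_log_lengths (D := D) hℓ3
  -- the printed window as a filter of which p9's window is the `P″₁ < n` part
  have hSeq : ((Finset.Ico 1 ⌈bigP D ^ (0.498 : ℝ)⌉₊).filter
        (fun n : ℕ => bigP D ^ (0.496 : ℝ) < (n : ℝ))).filter (fun n : ℕ => P1pp D < n) =
      (Finset.Ico 1 (Nsupp D)).filter (fun n : ℕ => P1pp D < n ∧ (n : ℝ) < Skeleton.P3 D) := by
    ext n
    simp only [Finset.mem_filter, Finset.mem_Ico]
    constructor
    · rintro ⟨⟨⟨h1, hhi⟩, -⟩, hlo⟩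
      have hhi' : (n : ℝ) < bigP D ^ (0.498 : ℝ) := Nat.lt_ceil.mp hhi
      exact ⟨⟨h1, hN n (by linarith)⟩, hlo, by rw [hP3def]; exact hhi'⟩
    · rintro ⟨⟨h1, -⟩, hlo, hhi⟩
      rw [hP3def] at hhi
      exact ⟨⟨⟨h1, Nat.lt_ceil.mpr hhi⟩, lt_of_le_of_lt h496 hlo⟩, hlo⟩
  unfold winSum
  rw [← hSeq, ← Finset.sum_filter_add_sum_filter_not ((Finset.Ico 1 ⌈bigP D ^ (0.498 : ℝ)⌉₊).filter
    (fun n : ℕ => bigP D ^ (0.496 : ℝ) < (n : ℝ))) (fun n : ℕ => P1pp D < n), add_sub_cancel_left]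
  have h := norm_boundary_window_le c' χ j 6 hℓ3 hc5 hQ6 hQ6P (u := bigP D ^ (0.496 : ℝ)) (v := P1pp D)
    h2 h496 hP1ppP
    (S := ((Finset.Ico 1 ⌈bigP D ^ (0.498 : ℝ)⌉₊).filter
      (fun n : ℕ => bigP D ^ (0.496 : ℝ) < (n : ℝ))).filter (fun n : ℕ => ¬ P1pp D < n))
    (fun n hn => by
      simp only [Finset.mem_filter, not_lt] at hn
      exact ⟨hn.1.2.le, hn.2⟩)
  refine h.trans ?_
  have hsq : ell D ≤ ell D ^ 2 := by nlinarith
  have h6' : 3 + Real.log (P1pp D) - Real.log (bigP D ^ (0.496 : ℝ)) ≤ 523 * ell D ^ 2 := by linarith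
  have h0 : 0 ≤ 146 * (1 * (1 + 7 * π)) * Real.exp 256 := by positivity
  have := mul_le_mul_of_nonneg_left h6' h0
  linarith [this]

/-- **Boundary windows `μ = 7`**: the printed window sum `Σ_{P^{0.496}<n<P^{0.5}}` minus zl-w12-p9's
`Σ_{P″₁<n<P₂, n<⌈PT⁻²⌉}` is the sum over `(P^{0.496}, P″₁] ∪ [P₂, P^{0.5})`, of norm `≤ 146(1+7π)e^{256}·1059𝓛²`.
[cite: Zhang2022LandauSiegel, §12 (12.16) p.73] -/
theorem window7_bridge (j : ℕ) (hℓ4 : 4 ≤ ell D) (hc5 : 5 * |c'| * alpha D * ell D ≤ 1) :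
    ‖winSum c' χ j (bigP D ^ (0.496 : ℝ)) (bigP D ^ (0.5 : ℝ))
          (fun n => frakgW c' D j 7 (bigP D ^ (0.5 : ℝ) / n) * frakwStarEx c' D j n) -
        ∑ n ∈ (Finset.Ico 1 (Nsupp D)).filter (fun n : ℕ => P1pp D < n ∧ (n : ℝ) < Skeleton.P2 D),
          (‖χ (n : ZMod D)‖ : ℂ) * lamZero c' D j n / (Nat.totient n : ℂ) *
            (frakgW c' D j 7 (bigP D ^ (0.5 : ℝ) / n) * frakwStarEx c' D j n)‖ ≤
      146 * (1 * (1 + 7 * π)) * Real.exp 256 * (1059 * ell D ^ 2) := by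
  have hℓ3 : 3 ≤ ell D := by linarith
  have hℓ1 : 1 ≤ ell D := by linarith
  have hℓ4' : 4 ≤ Real.log D := by rw [← ell]; exact hℓ4
  have hP1 : 1 ≤ bigP D := one_le_bigP D
  obtain ⟨h2, -, h80, h04, -, h5P, hN⟩ := range_facts (D := D) hℓ3
  obtain ⟨h496, -, hP2le, hP3def, -⟩ := TopRangeA15.window_facts (D := D) hℓ3
  have hP1ppP := P1pp_le_bigP (D := D) hℓ3
  have hP3P2 : Skeleton.P3 D ≤ Skeleton.P2 D := Sec12D.P3_le_P2 hℓ4'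
  have hP2two : 2 ≤ Skeleton.P2 D := by
    obtain ⟨-, h68, -, -, -, -, -⟩ := range_facts (D := D) hℓ3
    rw [hP3def] at hP3P2; linarith
  have hQ7 : 1 ≤ bigP D ^ (0.5 : ℝ) := Real.one_le_rpow hP1 (by norm_num)
  obtain ⟨hlen6, hlen7⟩ := boundary_log_lengths (D := D) hℓ3
  have hSeq : ((Finset.Ico 1 ⌈bigP D ^ (0.5 : ℝ)⌉₊).filter
        (fun n : ℕ => bigP D ^ (0.496 : ℝ) < (n : ℝ))).filter
          (fun n : ℕ => P1pp D < n ∧ (n : ℝ) < Skeleton.P2 D) =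
      (Finset.Ico 1 (Nsupp D)).filter (fun n : ℕ => P1pp D < n ∧ (n : ℝ) < Skeleton.P2 D) := by
    ext n
    simp only [Finset.mem_filter, Finset.mem_Ico]
    constructor
    · rintro ⟨⟨⟨h1, -⟩, -⟩, hlo, hhi⟩
      exact ⟨⟨h1, hN n (by linarith)⟩, hlo, hhi⟩
    · rintro ⟨⟨h1, -⟩, hlo, hhi⟩
      exact ⟨⟨⟨h1, Nat.lt_ceil.mpr (lt_of_lt_of_le hhi hP2le)⟩, lt_of_le_of_lt h496 hlo⟩, hlo, hhi⟩
  unfold winSum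
  rw [← hSeq, ← Finset.sum_filter_add_sum_filter_not ((Finset.Ico 1 ⌈bigP D ^ (0.5 : ℝ)⌉₊).filter
    (fun n : ℕ => bigP D ^ (0.496 : ℝ) < (n : ℝ))) (fun n : ℕ => P1pp D < n ∧ (n : ℝ) < Skeleton.P2 D),
    add_sub_cancel_left]
  -- the complement splits into `n ≤ P″₁` and `P₂ ≤ n`
  rw [← Finset.sum_filter_add_sum_filter_not (((Finset.Ico 1 ⌈bigP D ^ (0.5 : ℝ)⌉₊).filter
    (fun n : ℕ => bigP D ^ (0.496 : ℝ) < (n : ℝ))).filter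
      (fun n : ℕ => ¬ (P1pp D < n ∧ (n : ℝ) < Skeleton.P2 D))) (fun n : ℕ => (n : ℝ) ≤ P1pp D)]
  have hlow := norm_boundary_window_le c' χ j 7 hℓ3 hc5 hQ7 h5P (u := bigP D ^ (0.496 : ℝ))
    (v := P1pp D) h2 h496 hP1ppP
    (S := ((((Finset.Ico 1 ⌈bigP D ^ (0.5 : ℝ)⌉₊).filter
      (fun n : ℕ => bigP D ^ (0.496 : ℝ) < (n : ℝ))).filter
        (fun n : ℕ => ¬ (P1pp D < n ∧ (n : ℝ) < Skeleton.P2 D))).filter (fun n : ℕ => (n : ℝ) ≤ P1pp D)))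
    (fun n hn => by
      simp only [Finset.mem_filter] at hn
      exact ⟨hn.1.1.2.le, hn.2⟩)
  have hhigh := norm_boundary_window_le c' χ j 7 hℓ3 hc5 hQ7 h5P (u := Skeleton.P2 D)
    (v := bigP D ^ (0.5 : ℝ)) hP2two hP2le h5P
    (S := ((((Finset.Ico 1 ⌈bigP D ^ (0.5 : ℝ)⌉₊).filter
      (fun n : ℕ => bigP D ^ (0.496 : ℝ) < (n : ℝ))).filter
        (fun n : ℕ => ¬ (P1pp D < n ∧ (n : ℝ) < Skeleton.P2 D))).filter (fun n : ℕ => ¬ (n : ℝ) ≤ P1pp D)))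
    (fun n hn => by
      simp only [Finset.mem_filter, Finset.mem_Ico, not_and, not_lt, not_le] at hn
      obtain ⟨⟨⟨⟨-, hhi⟩, -⟩, himp⟩, hlo⟩ := hn
      exact ⟨himp hlo, (Nat.lt_ceil.mp hhi).le⟩)
  refine (norm_add_le _ _).trans ((add_le_add hlow hhigh).trans ?_)
  have hsq : ell D ≤ ell D ^ 2 := by nlinarith
  have h6' : 3 + Real.log (P1pp D) - Real.log (bigP D ^ (0.496 : ℝ)) ≤ 523 * ell D ^ 2 := by linarith
  have h7' : 3 + Real.log (bigP D ^ (0.5 : ℝ)) - Real.log (Skeleton.P2 D) ≤ 536 * ell D ^ 2 := by linarith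
  have h0 : 0 ≤ 146 * (1 * (1 + 7 * π)) * Real.exp 256 := by positivity
  have m6 := mul_le_mul_of_nonneg_left h6' h0
  have m7 := mul_le_mul_of_nonneg_left h7' h0
  linarith [m6, m7]

/-- **The range bridge for u049** (printed windows ↔ the windows the re-indexing delivers): for all large `D` and
`j = 1,2,3`, `main12u049sumEx` differs from zl-w12-p9's `X₆ + X₇` (windows `P″₁ < n < P₃`, `P″₁ < n < P₂` inside
`Ico 1 ⌈PT⁻²⌉`) by at most `εα` — the boundary windows `(P^{0.496}, P″₁]` and `[P₂, P^{0.5})` are `≪ 𝓛⁶/𝓛¹⁸`.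
[cite: Zhang2022LandauSiegel, §12 (12.16) p.73] -/
theorem sumEx_sub_windows :
    ∀ ε : ℝ, 0 < ε → ForAllLarge fun D _ χ => ∀ j ∈ ({1, 2, 3} : Finset ℕ),
      ‖main12u049sumEx c' χ j -
          (deriv χ.LFunction 1 ^ 2 * iota3 / (0.504 * 0.498 * (Real.log (bigP D) : ℂ) ^ 2) *
              ∑ n ∈ (Finset.Ico 1 (Nsupp D)).filter
                  (fun n : ℕ => P1pp D < n ∧ (n : ℝ) < Skeleton.P3 D),
                (‖χ (n : ZMod D)‖ : ℂ) * lamZero c' D j n / (Nat.totient n : ℂ) *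
                  (frakgW c' D j 6 (bigP D ^ (0.498 : ℝ) / n) *
                    ((((n : ℝ) / P1pp D : ℝ) : ℂ) ^ (-beta6 D) *
                      (-1 + (beta6 D - betaJ c' D j) * (Real.log ((n : ℝ) / P1pp D) : ℂ)))) +
            deriv χ.LFunction 1 ^ 2 * iota4 / (0.504 * 0.5 * (Real.log (bigP D) : ℂ) ^ 2) *
              ∑ n ∈ (Finset.Ico 1 (Nsupp D)).filter
                  (fun n : ℕ => P1pp D < n ∧ (n : ℝ) < Skeleton.P2 D),
                (‖χ (n : ZMod D)‖ : ℂ) * lamZero c' D j n / (Nat.totient n : ℂ) *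
                  (frakgW c' D j 7 (bigP D ^ (0.5 : ℝ) / n) *
                    ((((n : ℝ) / P1pp D : ℝ) : ℂ) ^ (-beta6 D) *
                      (-1 + (beta6 D - betaJ c' D j) * (Real.log ((n : ℝ) / P1pp D) : ℂ)))))‖ ≤
        ε * alpha D := by
  intro ε hε
  obtain ⟨A, hAdef⟩ : ∃ A : ℝ, A = 150 * Real.exp 9 := ⟨_, rfl⟩
  obtain ⟨W, hWdef⟩ : ∃ W : ℝ, W = 146 * (1 * (1 + 7 * π)) * Real.exp 256 := ⟨_, rfl⟩
  have hA0 : 0 ≤ A := by rw [hAdef]; positivity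
  have hW0 : 0 ≤ W := by rw [hWdef]; positivity
  have hbig : ForAllLarge fun D _ _ => A * W * 1582 / (ε * π) + 1 ≤ ell D := by
    refine ⟨⌈Real.exp (A * W * 1582 / (ε * π) + 1)⌉₊, fun D _ χ hD _ _ => ?_⟩
    have hexp : Real.exp (A * W * 1582 / (ε * π) + 1) ≤ D := le_trans (Nat.le_ceil _) (by exact_mod_cast hD)
    show A * W * 1582 / (ε * π) + 1 ≤ Real.log D
    exact (Real.le_log_iff_exp_le (lt_of_lt_of_le (Real.exp_pos _) hexp)).mpr hexp
  refine ((forAllLarge_five_c c').and hbig).mono ?_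
  intro D _ χ _ hp ⟨⟨_, hℓ6, hc5⟩, hℓbig⟩ j _
  have hℓ3 : 3 ≤ ell D := by linarith
  have hℓ4 : 4 ≤ ell D := by linarith
  have hℓ1 : 1 ≤ ell D := by linarith
  have hΛ : Real.log (bigP D) = ell D ^ 9 := by rw [bigP, Real.log_exp]
  have hαeq : alpha D = π / ell D ^ 9 := by rw [alpha, hΛ]
  obtain ⟨hι3, hι4⟩ := norm_iota34_le
  have hB6 := window6_bridge c' χ j hℓ4 hc5
  have hB7 := window7_bridge c' χ j hℓ4 hc5
  rw [← hWdef] at hB6 hB7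
  -- prefactors
  have hK6n : ‖deriv χ.LFunction 1 ^ 2 * iota3 / (0.504 * 0.498 * (Real.log (bigP D) : ℂ) ^ 2)‖ ≤
      A * ell D ^ 4 / ell D ^ 18 := by
    have h := norm_K1522_le χ hℓ3 hp (ι := iota3) (by linarith) (θ := 0.498) (by norm_num)
    have e : ((0.498 : ℝ) : ℂ) = (0.498 : ℂ) := by norm_num
    rw [e] at h; rw [hAdef]; exact h
  have hK7n : ‖deriv χ.LFunction 1 ^ 2 * iota4 / (0.504 * 0.5 * (Real.log (bigP D) : ℂ) ^ 2)‖ ≤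
      A * ell D ^ 4 / ell D ^ 18 := by
    have h := norm_K1522_le χ hℓ3 hp (ι := iota4) hι4 (θ := 0.5) (by norm_num)
    have e : ((0.5 : ℝ) : ℂ) = (0.5 : ℂ) := by norm_num
    rw [e] at h; rw [hAdef]; exact h
  -- the difference is `K6·(boundary₆) + K7·(boundary₇)`
  unfold main12u049sumEx
  rw [show ∀ (K6 K7 W6 W7 X6 X7 : ℂ), K6 * W6 + K7 * W7 - (K6 * X6 + K7 * X7) = K6 * (W6 - X6) + K7 * (W7 - X7)
    from fun _ _ _ _ _ _ => by ring]
  refine (norm_add_le _ _).trans ?_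
  rw [norm_mul, norm_mul]
  calc _ ≤ ε * (π / ell D ^ 9) :=
        arith_bridge hℓ1 hε hA0 hW0 hK6n hK7n hB6 hB7 (norm_nonneg _) (norm_nonneg _) hℓbig
    _ = ε * alpha D := by rw [hαeq]

end Bridge

/-! ## The unconditional closers -/

section Closers

variable (c' : ℝ)

/-- The relative Lemma 8.4 is a THEOREM of the tree (App. A §A.u007 theorems ⇒ Lemma 8.3ᴿ ⇒ Lemma 8.4ᴿ; as in
`Section12Low1522Leaves`). [cite: Zhang2022LandauSiegel, §8 Lemma 8.4 p.46; App. A] -/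
theorem lemma84Rel_holds : Lemma84Rel c' :=
  lemma84Rel_of_lemma83Rel (Lemma83.lemma83Rel_of_parts c' (Typed.AppendixA1.stepA_u007_analytic_holds c')
    (Typed.AppendixA1.stepA_u007_read_holds c'))

/-- `Lemma84Rel` — `_holds` alias of `lemma84Rel_holds` above under the fact's exact name (appended
2026-08-28, D-0026 bookkeeping: the proof term is the existing theorem of this file; no statement,
definition or attribute is edited; no new named fact; the ledger's debt table listed the fact
unproved). [cite: Zhang2022LandauSiegel, §8 Lemma 8.4 p.46; App. A] -/
theorem _root_.Literature.NumberTheory.LFunctions.Zhang2022.Skeleton.Lemma84Rel_holds :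
    Lemma84Rel c' :=
  _root_.Literature.NumberTheory.LFunctions.Zhang2022.Typed.Sec12C.lemma84Rel_holds (c' := c')

/-- **The EVAL half of u049 in the typed currency**: `S_j|_{P″₁<dr<P₂}(𝐚₁₅,𝐚₂₂) = main12u049sumEx + o(α)` for every
`c′` (zl-w12-p9's edge at the theorem `lemma84Rel_holds`, moved to the printed windows by `sumEx_sub_windows`).
[cite: Zhang2022LandauSiegel, §12 (12.16) p.73] -/
theorem sjOn_top_a15_sub_sumEx :
    ∀ ε : ℝ, 0 < ε → ForAllLarge fun D _ χ => AssumptionA D χ →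
      ∀ a15 : ℕ → ℂ, (∀ n, a15 n = χ (n : ZMod D) * vk13 D n) →
        ∀ j ∈ ({1, 2, 3} : Finset ℕ),
          ‖SjOn c' D j a15 (a22 χ) (rngTop D) - main12u049sumEx c' χ j‖ ≤ ε * alpha D := by
  intro ε hε
  have hε2 : 0 < ε / 2 := by positivity
  refine ((sjOn_top_a15_sum_of_rel c' (lemma84Rel_holds c') (ε / 2) hε2).and
    (sumEx_sub_windows c' (ε / 2) hε2)).mono ?_
  intro D _ χ _ _ ⟨hE, hB⟩ hA a15 ha15 j hj
  have h1 := hE hA a15 ha15 j hj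
  have h2 := hB j hj
  have h2' := norm_sub_rev (main12u049sumEx c' χ j) _ ▸ h2
  calc ‖SjOn c' D j a15 (a22 χ) (rngTop D) - main12u049sumEx c' χ j‖
      ≤ ‖SjOn c' D j a15 (a22 χ) (rngTop D) - _‖ + ‖_ - main12u049sumEx c' χ j‖ := norm_sub_le_norm_sub_add_norm_sub _ _ _
    _ ≤ ε / 2 * alpha D + ε / 2 * alpha D := add_le_add h1 h2'
    _ = ε * alpha D := by ring

/-- **`Z22:§12.u049` (exact reading) HOLDS: `Typed.Sec12C.Top1522Ex c′` for every real `c′`** — the RT-02 binder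
`hTop1522` of `theorem1_of_leaves` is a THEOREM (EVAL half: zl-w12-p9 `Section12TopRangeA15`; INT half:
`Section12Top1522Int`; bridge and glue: this lane). [cite: Zhang2022LandauSiegel, §12 (12.16) p.73] -/
theorem top1522Ex_holds : Top1522Ex c' :=
  top1522Ex_of_eval c' (sjOn_top_a15_sub_sumEx c')

/-- `Top1522Ex` — `_holds` alias of `top1522Ex_holds` above under the fact's exact name (appended
2026-08-28, D-0026 bookkeeping: the proof term is the existing theorem of this file; no statement,
definition or attribute is edited; no new named fact; the ledger's debt table listed the fact
unproved). [cite: Zhang2022LandauSiegel, §12 (12.16) p.73] -/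
theorem _root_.Literature.NumberTheory.LFunctions.Zhang2022.Typed.Sec12C.Top1522Ex_holds :
    Top1522Ex c' :=
  _root_.Literature.NumberTheory.LFunctions.Zhang2022.Typed.Sec12C.top1522Ex_holds (c' := c')

/-- **(12.16) HOLDS AS PRINTED: `Typed.Sec12C.Eq1216 c′` for every real `c′`** —
"`(1/2α)S₁(𝐚₁₅,𝐚₂₂) + (2/α)S₂(𝐚₁₅,𝐚₂₂) + (3/2α)S₃(𝐚₁₅,𝐚₂₂) = 𝔞(conj e₂* + ε/2)`" (p. 73, tex L3710): the v19 leaf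
`h1216` of `Skeleton.theorem1_of_leaves_v19` is a THEOREM (`Sec12D.eq1216_of_top1522Ex` at `top1522Ex_holds`).
[cite: Zhang2022LandauSiegel, §12 (12.16) p.73] -/
theorem eq1216_holds : Eq1216 c' :=
  Sec12D.eq1216_of_top1522Ex c' (top1522Ex_holds c')

/-- `Eq1216` — `_holds` alias of `eq1216_holds` above under the fact's exact name (appended
2026-08-28, D-0026 bookkeeping: the proof term is the existing theorem of this file; no statement,
definition or attribute is edited; no new named fact; the ledger's debt table listed the fact
unproved). [cite: Zhang2022LandauSiegel, §12 (12.16) p.73] -/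
theorem _root_.Literature.NumberTheory.LFunctions.Zhang2022.Typed.Sec12C.Eq1216_holds : Eq1216 c' :=
  _root_.Literature.NumberTheory.LFunctions.Zhang2022.Typed.Sec12C.eq1216_holds (c' := c')

end Closers

end Literature.NumberTheory.LFunctions.Zhang2022.Typed.Sec12C
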